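import Summits.ResolutionOfSingularities.ResolutionOfSingularities.Theorems.WildQuotientsSummitReductionStubPairOrbitBlowupClaimLemmas
import Summits.ResolutionOfSingularities.ResolutionOfSingularities.Theorems.WildQuotientsSummitReductionStubPairSsCodimThreeOrbit
import HarnessLib

/-!
# `WildQuotients.SummitReduction` (stmt-ResolutionOfSingularities-16324), line `FramePerfect`:
# stub hB (`stub_pair_orbitBlowupClaim`) reduced to its content over the exceptional locus

Route `ResolutionOfSingularities/WildQuotients`, crux `SummitReduction`; helper file of the line
skeleton `Cruxes/SummitReduction/Lines/FramePerfect.lean` (v7), stub hB = de Jong 1996, 3.4, the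
Claim (ii)–(iii) for ONE blowing up `π : X₁ ⟶ X` of the reduced orbit closure `Z = cl(G · x)` of a
codimension-2 singular point `x` of a `G`-semi-stable quasi-split pair, with quasi-splitness
upstairs (de Jong 1997, proof of Prop. 5.11 ¶1).

This file is the equivariant, quasi-split analogue of the tree's
`DeJong1996SemiStableCodimTwoBlowupCentre.of_fibres` / `DeJong1996SemiStableCodimTwoBlowup.of_core`
(one component, algebraically closed field): **everything in hB that happens OFF the exceptional
locus `π⁻¹(Z)` is PROVED** (`…StubPairOrbitBlowupClaimLemmas`: `π` is an isomorphism over `X ∖ Z`,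
Stacks 02OS), so that hB rests on six statements read off the three charts of p. 64 AT THE POINTS
OVER `Z` only: (H1) flatness of `π ≫ f` at the points over `Z`; (H2) the closed points over `Z` of
the geometric fibres of `π ≫ f` are nonsingular points of curves or ordinary double points; (H3) the
fibres of `π` over the points of `Z` are geometrically connected; (H4) quasi-splitness of `π ≫ f`
at its non-smooth points over `Z`; (H5) a codimension-`≤ 2` singular point of `X₁` over `Z` lies
over the orbit `G · x` itself, with `n + 2 = n(x)`; (H6) over `Z`, `π` is injective on
codimension-`≤ 2` singular points. In the tree, over an algebraically closed field and for one
component `Z = cl{x}`: (H1) is `DeJong1996.SemiStablePair.flat_stalkMap_comp_blowup_of_mem_closure`,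
(H3) is `DeJong1996SemiStableCodimTwoBlowupExceptionalConnected_holds`, (H5)–(H6) are
`DeJong1996SemiStableCodimTwoBlowupNewComponent_holds`, (H2) is the OPEN leaf
`DeJong1996SemiStableCodimTwoBlowupNodalFibres` (clause (b) of
`DeJong1996SemiStableCodimTwoBlowupFlatNodal`), and (H4) is not rendered.

* `exists_smooth_of_exists_smooth_of_isBlowup`, `injOn_of_isBlowup_vanishingIdeal` — off the
  centre: smoothness of `f` near `π x'` lifts to smoothness of `π ≫ f` near `x'`; `π` is injective;
* `apply_mem_of_not_isRegularLocalRing_of_smooth` — 3.1: a non-regular point of `X` lies over `D`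
  when `f` is smooth over the regular `Y ∖ D`;
* `quasiSplit_comp_of_isBlowup_vanishingIdeal` — clause (b) of hB (quasi-splitness of `π ≫ f`)
  from (H4), for any closed centre;
* `stub_pair_orbitBlowupClaim_core_of_centre` — clauses (a), (c)–(g) of hB, with the binders of
  the registered stub (those used), from (H1)–(H3), (H5)–(H6); hB itself is
  `⟨h.1, quasiSplit_comp_of_isBlowup_vanishingIdeal …, h.2⟩` of the two (two entry theorems rather
  than one only to keep each registered signature within the stub registry's size bound).
-/

-- the problem path `ResolutionOfSingularities/ResolutionOfSingularities` makes the conventional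
-- namespace repeat a component, which `linter.dupNamespace` flags
set_option linter.dupNamespace false

noncomputable section

open CategoryTheory CategoryTheory.Limits AlgebraicGeometry TopologicalSpace
open Literature.AlgebraicGeometry.Resolution
open Literature.AlgebraicGeometry
open Scheme.IdealSheafData

namespace Summit.ResolutionOfSingularities.ResolutionOfSingularities.Theorems

/-! ## Off the centre (continued from `…StubPairOrbitBlowupClaimLemmas`) -/

/-- Off the centre, smoothness of `f` near `π x'` gives smoothness of `π ≫ f` near `x'`: over the
open `U ∩ (X ∖ Z)` the blow-up `π` is an isomorphism, so `π⁻¹(U ∖ Z) → U ∖ Z → U → Y` is smooth.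
[cite: StacksProject, Tag 02OS] -/
theorem exists_smooth_of_exists_smooth_of_isBlowup {X₁ X Y : Scheme.{0}} {π : X₁ ⟶ X}
    (f : X ⟶ Y) {Z : Set X} (hZ : IsClosed Z) (hπ : IsBlowup π (vanishingIdeal ⟨Z, hZ⟩))
    {x' : X₁} (hx' : π.base x' ∉ Z) (h : ∃ U : X.Opens, π.base x' ∈ U ∧ Smooth (U.ι ≫ f)) :
    ∃ U₁ : X₁.Opens, x' ∈ U₁ ∧ Smooth (U₁.ι ≫ (π ≫ f)) := by
  obtain ⟨U, hxU, hU⟩ := h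
  let V : X.Opens := U ⊓ centreCompl (vanishingIdeal ⟨Z, hZ⟩)
  have hxV : π.base x' ∈ V := by
    refine ⟨hxU, ?_⟩
    show π.base x' ∈ ((vanishingIdeal ⟨Z, hZ⟩).support : Set X)ᶜ
    rw [Scheme.IdealSheafData.coe_support_vanishingIdeal]
    exact hx'
  haveI : IsIso (π ∣_ V) := hπ.isIso_morphismRestrict (U := V) (by
    refine Set.disjoint_left.mpr fun y hy hy' => ?_
    exact hy.2 hy')
  haveI : Smooth (U.ι ≫ f) := hU
  have hVU : V ≤ U := inf_le_left
  haveI : Smooth (V.ι ≫ f) := by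
    rw [← X.homOfLE_ι hVU, Category.assoc]
    infer_instance
  refine ⟨π ⁻¹ᵁ V, hxV, ?_⟩
  have : (π ⁻¹ᵁ V).ι ≫ (π ≫ f) = (π ∣_ V) ≫ (V.ι ≫ f) := by
    rw [← Category.assoc, ← morphismRestrict_ι, Category.assoc]
  rw [this]
  infer_instance

/-- **Off a closed centre a blow-up in its reduced ideal is injective** (it is an isomorphism,
in particular an open embedding, over `X ∖ Z`). [cite: StacksProject, Tag 02OS] -/
theorem injOn_of_isBlowup_vanishingIdeal {X₁ X : Scheme.{0}} {π : X₁ ⟶ X} {Z : Set X}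
    (hZ : IsClosed Z) (hπ : IsBlowup π (vanishingIdeal ⟨Z, hZ⟩)) :
    Set.InjOn π.base (π.base ⁻¹' Zᶜ) := by
  let U : X.Opens := centreCompl (vanishingIdeal ⟨Z, hZ⟩)
  haveI : IsIso (π ∣_ U) := hπ.isIso_compl
  have hUeq : (U : Set X) = Zᶜ := by
    show ((vanishingIdeal ⟨Z, hZ⟩).support : Set X)ᶜ = _
    rw [Scheme.IdealSheafData.coe_support_vanishingIdeal]
    rfl
  intro a ha b hb hab
  have ha' : a ∈ π ⁻¹ᵁ U := by
    show π.base a ∈ (U : Set X)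
    rw [hUeq]
    exact ha
  have hb' : b ∈ π ⁻¹ᵁ U := by
    show π.base b ∈ (U : Set X)
    rw [hUeq]
    exact hb
  have heq : (π ∣_ U) ⟨a, ha'⟩ = (π ∣_ U) ⟨b, hb'⟩ := by
    apply Subtype.ext
    rw [morphismRestrict_base_coe, morphismRestrict_base_coe]
    exact hab
  exact congrArg Subtype.val ((π ∣_ U).isOpenEmbedding.injective heq)

/-! ## 3.1: the singular points lie over `D` -/

/-- **de Jong 1996, 3.1 ("the singular locus `Sing(X)` of the scheme `X` is contained in
`Sing(f)`"), in the form: a non-regular point of `X` maps into `D`** — over the open `Y ∖ D` the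
morphism `f` is smooth and `Y` is regular, so `X` is regular there (EGA IV₄ 17.5.8 (iii),
`isRegularLocalRing_of_smooth_of_isRegular`). [cite: DeJong1996, 3.1, p. 62] -/
theorem apply_mem_of_not_isRegularLocalRing_of_smooth {X Y : Scheme.{0}} [IsLocallyNoetherian Y]
    (hreg : Scheme.IsRegular Y) (f : X ⟶ Y) {D : Set Y} (hD : IsClosed D)
    (hsm : Smooth (f ∣_ ⟨Dᶜ, hD.isOpen_compl⟩)) {x : X}
    (hx : ¬ IsRegularLocalRing (X.presheaf.stalk x)) : f.base x ∈ D := by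
  by_contra hxD
  let V : Y.Opens := ⟨Dᶜ, hD.isOpen_compl⟩
  have hxV : x ∈ f ⁻¹ᵁ V := hxD
  haveI : Smooth (f ∣_ V) := hsm
  have hsmV : Smooth ((f ⁻¹ᵁ V).ι ≫ f) := by
    rw [← morphismRestrict_ι]
    infer_instance
  exact hx (isRegularLocalRing_of_smooth_of_isRegular hreg f hsmV hxV)

/-! ## Quasi-splitness upstairs from its content over the exceptional locus -/

/-- **Clause (b) of hB — quasi-splitness of `π ≫ f` — from its content over the centre.** For a
blowing up `π : X₁ → X` in the reduced ideal sheaf of a closed `Z ⊆ X` and any `f : X → Y`: if `f`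
is quasi-split at its non-smooth points (the line's rendering on completed fibre local rings,
`(𝒪_{X,x}/𝔪_y𝒪_{X,x})^ ≅ κ(y)⟦u, v⟧/(uv)` compatibly with `κ(y)`) and `π ≫ f` is quasi-split at its
non-smooth points OVER `Z`, then `π ≫ f` is quasi-split at all its non-smooth points: off `Z` the
blow-up is a local isomorphism over `Y` (Stacks 02OS), non-smoothness of `π ≫ f` at `x'` forces
non-smoothness of `f` at `π x'` (`exists_smooth_of_exists_smooth_of_isBlowup`), and the rendering
transports along the stalk isomorphism (`quasiSplitAt_comp_of_isIso_stalkMap`). (de Jong 1997,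
proof of Prop. 5.11 ¶1: "the singular points of the fibres of `X' → Y` in `E` are rational with
rational tangents", the points off `E` being those of `f`.) [cite: DeJong1997, proof of Prop. 5.11, p. 618] -/
theorem quasiSplit_comp_of_isBlowup_vanishingIdeal {X₁ X Y : Scheme.{0}} (f : X ⟶ Y) {Z : Set X}
    (hZ : IsClosed Z) {π : X₁ ⟶ X} (hπ : IsBlowup π (vanishingIdeal ⟨Z, hZ⟩))
    (hqs : (∀ x : X, (¬ ∃ U : X.Opens, x ∈ U ∧ Smooth (U.ι ≫ f)) →
        ∃ e : AdicCompletion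
            ((IsLocalRing.maximalIdeal (X.presheaf.stalk x)).map (Ideal.Quotient.mk
              ((IsLocalRing.maximalIdeal (Y.presheaf.stalk (f.base x))).map (f.stalkMap x).hom)))
            (X.presheaf.stalk x ⧸
              (IsLocalRing.maximalIdeal (Y.presheaf.stalk (f.base x))).map (f.stalkMap x).hom) ≃+*
          MvPowerSeries (Fin 2) (Y.presheaf.stalk (f.base x) ⧸ IsLocalRing.maximalIdeal (Y.presheaf.stalk (f.base x))) ⧸
            Ideal.span {(MvPowerSeries.X 0 * MvPowerSeries.X 1 :
              MvPowerSeries (Fin 2) (Y.presheaf.stalk (f.base x) ⧸ IsLocalRing.maximalIdeal (Y.presheaf.stalk (f.base x))))},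
          e.toRingHom.comp ((algebraMap (X.presheaf.stalk x ⧸
              (IsLocalRing.maximalIdeal (Y.presheaf.stalk (f.base x))).map (f.stalkMap x).hom) _).comp
            (Ideal.quotientMap ((IsLocalRing.maximalIdeal (Y.presheaf.stalk (f.base x))).map (f.stalkMap x).hom)
              (f.stalkMap x).hom Ideal.le_comap_map)) =
          algebraMap (Y.presheaf.stalk (f.base x) ⧸ IsLocalRing.maximalIdeal (Y.presheaf.stalk (f.base x))) _))
    (hqsZ : ∀ x : X₁, π.base x ∈ Z → (¬ ∃ U : X₁.Opens, x ∈ U ∧ Smooth (U.ι ≫ (π ≫ f))) →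
        ∃ e : AdicCompletion
            ((IsLocalRing.maximalIdeal (X₁.presheaf.stalk x)).map (Ideal.Quotient.mk
              ((IsLocalRing.maximalIdeal (Y.presheaf.stalk ((π ≫ f).base x))).map ((π ≫ f).stalkMap x).hom)))
            (X₁.presheaf.stalk x ⧸
              (IsLocalRing.maximalIdeal (Y.presheaf.stalk ((π ≫ f).base x))).map ((π ≫ f).stalkMap x).hom) ≃+*
          MvPowerSeries (Fin 2) (Y.presheaf.stalk ((π ≫ f).base x) ⧸ IsLocalRing.maximalIdeal (Y.presheaf.stalk ((π ≫ f).base x))) ⧸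
            Ideal.span {(MvPowerSeries.X 0 * MvPowerSeries.X 1 :
              MvPowerSeries (Fin 2) (Y.presheaf.stalk ((π ≫ f).base x) ⧸ IsLocalRing.maximalIdeal (Y.presheaf.stalk ((π ≫ f).base x))))},
          e.toRingHom.comp ((algebraMap (X₁.presheaf.stalk x ⧸
              (IsLocalRing.maximalIdeal (Y.presheaf.stalk ((π ≫ f).base x))).map ((π ≫ f).stalkMap x).hom) _).comp
            (Ideal.quotientMap ((IsLocalRing.maximalIdeal (Y.presheaf.stalk ((π ≫ f).base x))).map ((π ≫ f).stalkMap x).hom)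
              ((π ≫ f).stalkMap x).hom Ideal.le_comap_map)) =
          algebraMap (Y.presheaf.stalk ((π ≫ f).base x) ⧸ IsLocalRing.maximalIdeal (Y.presheaf.stalk ((π ≫ f).base x))) _) :
    (∀ x : X₁, (¬ ∃ U : X₁.Opens, x ∈ U ∧ Smooth (U.ι ≫ (π ≫ f))) →
        ∃ e : AdicCompletion
            ((IsLocalRing.maximalIdeal (X₁.presheaf.stalk x)).map (Ideal.Quotient.mk
              ((IsLocalRing.maximalIdeal (Y.presheaf.stalk ((π ≫ f).base x))).map ((π ≫ f).stalkMap x).hom)))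
            (X₁.presheaf.stalk x ⧸
              (IsLocalRing.maximalIdeal (Y.presheaf.stalk ((π ≫ f).base x))).map ((π ≫ f).stalkMap x).hom) ≃+*
          MvPowerSeries (Fin 2) (Y.presheaf.stalk ((π ≫ f).base x) ⧸ IsLocalRing.maximalIdeal (Y.presheaf.stalk ((π ≫ f).base x))) ⧸
            Ideal.span {(MvPowerSeries.X 0 * MvPowerSeries.X 1 :
              MvPowerSeries (Fin 2) (Y.presheaf.stalk ((π ≫ f).base x) ⧸ IsLocalRing.maximalIdeal (Y.presheaf.stalk ((π ≫ f).base x))))},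
          e.toRingHom.comp ((algebraMap (X₁.presheaf.stalk x ⧸
              (IsLocalRing.maximalIdeal (Y.presheaf.stalk ((π ≫ f).base x))).map ((π ≫ f).stalkMap x).hom) _).comp
            (Ideal.quotientMap ((IsLocalRing.maximalIdeal (Y.presheaf.stalk ((π ≫ f).base x))).map ((π ≫ f).stalkMap x).hom)
              ((π ≫ f).stalkMap x).hom Ideal.le_comap_map)) =
          algebraMap (Y.presheaf.stalk ((π ≫ f).base x) ⧸ IsLocalRing.maximalIdeal (Y.presheaf.stalk ((π ≫ f).base x))) _) := by
  intro x' hx'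
  by_cases hZ' : π.base x' ∈ Z
  · exact hqsZ x' hZ' hx'
  · haveI := isIso_stalkMap_of_isBlowup_vanishingIdeal_of_notMem hZ hπ hZ'
    exact quasiSplitAt_comp_of_isIso_stalkMap π f x' (hqs (π.base x') fun hsmooth =>
      hx' (exists_smooth_of_exists_smooth_of_isBlowup f hZ hπ hZ' hsmooth))

/-! ## hB from its content over the exceptional locus -/

/-- **Stub hB (`stub_pair_orbitBlowupClaim`: de Jong 1996, 3.4, the Claim (ii)–(iii) for ONE
blowing up `π : X₁ ⟶ X` of the reduced orbit closure `Z = cl(G · x)` of a codimension-2 singular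
point) FROM ITS CONTENT OVER THE EXCEPTIONAL LOCUS — all clauses but quasi-splitness** (which is
`quasiSplit_comp_of_isBlowup_vanishingIdeal`; hB is `⟨h.1, quasiSplit…, h.2⟩` of the two). Binders:
those of the registered stub that are used (the action on the base `ρY`, the `G`-stability and
`G`-strictness of `D`, the equivariance of `f`, the finiteness of `G`, the projectivity of `Y` and
quasi-splitness play no role here), plus the statements that the printed proof reads off the three
charts of the blow-up of `Spec B'`, `B' = A[u, v]/(uv - t₁^{n₁} ⋯ t_r^{n_r})`, in `(u, v, t₁)` (p. 64)
at the points OVER `Z`: (H1) `π ≫ f` is flat at the points over `Z`; (H2) the closed points over `Z`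
of the geometric fibres of `π ≫ f` are nonsingular points of curves or ordinary double points
("This scheme is smooth over `k`, except at the maximal ideal `(u, t₁')`"); (H3) the fibres of `π`
over the points of `Z` are geometrically connected (the conics `{UV = c W²}`); (H5) a
codimension-`≤ 2` singular point of `X₁` over `Z` lies over the orbit `G · x` itself with
`n + 2 = n(x)` ("The "new" component `T̃` lying over `T` is given by `u' = v' = t₁ = 0` … Clearly,
`n_T` has dropped by 2"); (H6) over `Z`, `π` is injective on codimension-`≤ 2` singular points ("at
most one such `T̃`"). Conclusion: clauses (a), (c)–(g) of hB. Proof: `Z ⊆ Sing(X)` (the regular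
locus is open, `G` acts by automorphisms), so `I(Z) ≠ 0` and `π` is a modification; `Z ⊆ f⁻¹(D)`
(3.1); over `X ∖ Z` the blow-up `π` is an isomorphism (Stacks 02OS), whence 2.21
(`isSemiStableCurve_comp_of_isBlowup_vanishingIdeal`), smoothness over `Y ∖ D`
(`(π ≫ f)|_{Y∖D} = π| ≫ f|` with `π|` an isomorphism), and the clauses of (iii) off `Z` (stalk
isomorphisms preserve regularity, dimension and `n`, `Scheme.Hom.nodeThickness_comp_eq_of_isIso_stalkMap`;
injectivity off `Z`); over `Z` they are (H1)–(H3), (H5)–(H6).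
[cite: DeJong1996, 3.4 Claim (ii)–(iii), pp. 63–64] [cite: DeJong1997, proof of Prop. 5.11, p. 618] -/
theorem stub_pair_orbitBlowupClaim_core_of_centre (k : Type) [Field k] (Y : Scheme.{0}) [IsIntegral Y]
    (q : Y ⟶ Spec (.of k)) (hreg : Scheme.IsRegular Y) (D : Set Y)
    (hD : IsStrictNormalCrossingsDivisor Y D) (G : Type) [Group G]
    (X : Scheme.{0}) [IsIntegral X] (f : X ⟶ Y) (ρX : G →* Aut X)
    (hprojX : Motives.IsProjectiveOver (Over.mk (f ≫ q)))
    (hss : IsSemiStableCurve f)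
    (hsm : Smooth (f ∣_ ⟨Dᶜ, hD.isClosed.isOpen_compl⟩))
    (x : X) (hx : x ∈ Scheme.singularLocusCodimLE X 2) (X₁ : Scheme.{0}) (π : X₁ ⟶ X)
    (hπ : IsBlowup π (Scheme.IdealSheafData.vanishingIdeal
      ⟨closure (Set.range fun g : G => (ρX g).hom.base x), isClosed_closure⟩))
    (hflat : ∀ x' : X₁, π.base x' ∈ closure (Set.range fun g : G => (ρX g).hom.base x) →
      ((π ≫ f).stalkMap x').hom.Flat)
    (hnodal : ∀ (K : Type) [Field K] [IsAlgClosed K] (s : Spec (.of K) ⟶ Y)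
      (x' : ↥(pullback (π ≫ f) s)), IsClosed ({x'} : Set ↥(pullback (π ≫ f) s)) →
      π.base ((pullback.fst (π ≫ f) s).base x') ∈
        closure (Set.range fun g : G => (ρX g).hom.base x) →
        (IsRegularLocalRing ((pullback (π ≫ f) s).presheaf.stalk x') ∧
            ringKrullDim ((pullback (π ≫ f) s).presheaf.stalk x') = 1) ∨
          IsOrdinaryDoublePoint K x')
    (hconn : ∀ (K : Type) [Field K] [IsAlgClosed K] (c : Spec (.of K) ⟶ X),
      Set.range c.base ⊆ closure (Set.range fun g : G => (ρX g).hom.base x) →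
        ConnectedSpace ↥(pullback π c))
    (hnew : ∀ x₁ ∈ Scheme.singularLocusCodimLE X₁ 2,
      π.base x₁ ∈ closure (Set.range fun g : G => (ρX g).hom.base x) →
        π.base x₁ ∈ Set.range (fun g : G => (ρX g).hom.base x) ∧
          Scheme.Hom.nodeThickness (π ≫ f) x₁ + 2 = Scheme.Hom.nodeThickness f x)
    (huniq : ∀ x₁ ∈ Scheme.singularLocusCodimLE X₁ 2, ∀ x₁' ∈ Scheme.singularLocusCodimLE X₁ 2,
      π.base x₁ ∈ closure (Set.range fun g : G => (ρX g).hom.base x) →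
        π.base x₁ = π.base x₁' → x₁ = x₁') :
    IsSemiStableCurve (π ≫ f) ∧
    Smooth ((π ≫ f) ∣_ ⟨Dᶜ, hD.isClosed.isOpen_compl⟩) ∧
    Set.MapsTo π.base (Scheme.singularLocusCodimLE X₁ 2) (Scheme.singularLocusCodimLE X 2) ∧
    Set.InjOn π.base (Scheme.singularLocusCodimLE X₁ 2) ∧
    (∀ x₁ ∈ Scheme.singularLocusCodimLE X₁ 2,
      π.base x₁ ∉ Set.range (fun g : G => (ρX g).hom.base x) →
        Scheme.Hom.nodeThickness (π ≫ f) x₁ = Scheme.Hom.nodeThickness f (π.base x₁)) ∧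
    (∀ x₁ ∈ Scheme.singularLocusCodimLE X₁ 2,
      π.base x₁ ∈ Set.range (fun g : G => (ρX g).hom.base x) →
        Scheme.Hom.nodeThickness (π ≫ f) x₁ + 2 = Scheme.Hom.nodeThickness f x) := by
  haveI : IsNoetherian X := DeJong1996.isNoetherian_of_isProjectiveOver (f ≫ q) hprojX
  haveI : IsLocallyNoetherian Y := isLocallyNoetherian_base hss
  haveI : IsProper (f ≫ q) := Motives.IsProjectiveOver.isProper (X := Over.mk (f ≫ q)) hprojX
  -- `Z = cl(G · x) ⊆ Sing(X)`, `Z ⊆ f⁻¹(D)`, `I(Z) ≠ 0`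
  have hOsing : ∀ y ∈ Set.range (fun g : G => (ρX g).hom.base x),
      ¬ IsRegularLocalRing (X.presheaf.stalk y) := by
    rintro _ ⟨g, rfl⟩
    exact (mem_singularLocusCodimLE_of_iso (ρX g) hx).1
  have hZsing : ∀ y ∈ closure (Set.range fun g : G => (ρX g).hom.base x),
      ¬ IsRegularLocalRing (X.presheaf.stalk y) := fun y hy =>
    closure_subset_not_isRegularLocalRing f q hOsing hy
  have hZD : ∀ y ∈ closure (Set.range fun g : G => (ρX g).hom.base x), f.base y ∈ D := fun y hy =>
    apply_mem_of_not_isRegularLocalRing_of_smooth hreg f hD.isClosed hsm (hZsing y hy)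
  have hne : vanishingIdeal ⟨closure (Set.range fun g : G => (ρX g).hom.base x), isClosed_closure⟩ ≠ ⊥ :=
    vanishingIdeal_ne_bot_of_not_isRegularLocalRing isClosed_closure hZsing
  -- off `Z`, `π` is a local isomorphism
  have hiso : ∀ {x' : X₁}, π.base x' ∉ closure (Set.range fun g : G => (ρX g).hom.base x) →
      IsIso (π.stalkMap x') := fun h =>
    isIso_stalkMap_of_isBlowup_vanishingIdeal_of_notMem isClosed_closure hπ h
  refine ⟨isSemiStableCurve_comp_of_isBlowup_vanishingIdeal f hss isClosed_closure hne hπ hflat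
      hnodal hconn, ?_, fun x₁ hx₁ => ?_, fun x₁ hx₁ x₁' hx₁' heq => ?_,
    fun x₁ hx₁ hO => ?_, fun x₁ hx₁ hO => (hnew x₁ hx₁ (subset_closure hO)).2⟩
  · -- smooth over `Y ∖ D`
    let V : Y.Opens := ⟨Dᶜ, hD.isClosed.isOpen_compl⟩
    haveI : Smooth (f ∣_ V) := hsm
    haveI : IsIso (π ∣_ (f ⁻¹ᵁ V)) := hπ.isIso_morphismRestrict (U := f ⁻¹ᵁ V) (by
      refine Set.disjoint_left.mpr fun y hyV hyZ => ?_
      have hyZ' : y ∈ closure (Set.range fun g : G => (ρX g).hom.base x) := by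
        have h2 : y ∈ ((vanishingIdeal ⟨closure (Set.range fun g : G => (ρX g).hom.base x),
          isClosed_closure⟩).support : Set X) := hyZ
        rwa [Scheme.IdealSheafData.coe_support_vanishingIdeal] at h2
      exact hyV (hZD y hyZ'))
    haveI : IsOpenImmersion (π ∣_ (f ⁻¹ᵁ V)) := IsOpenImmersion.of_isIso _
    have h1 : Smooth (π ∣_ (f ⁻¹ᵁ V)) := inferInstance
    have hc : (π ≫ f) ∣_ V = (π ∣_ (f ⁻¹ᵁ V)) ≫ (f ∣_ V) := morphismRestrict_comp π f V
    show Smooth ((π ≫ f) ∣_ V)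
    rw [hc]
    exact MorphismProperty.comp_mem @Smooth _ _ h1 hsm
  · -- codimension-2 singular points go to codimension-2 singular points
    by_cases hZ : π.base x₁ ∈ closure (Set.range fun g : G => (ρX g).hom.base x)
    · obtain ⟨⟨g, hg⟩, -⟩ := hnew x₁ hx₁ hZ
      rw [← hg]
      exact mem_singularLocusCodimLE_of_iso (ρX g) hx
    · haveI := hiso hZ
      exact (mem_singularLocusCodimLE_iff_of_isIso_stalkMap π x₁ 2).mp hx₁
  · -- injectivity on codimension-2 singular points
    by_cases hZ : π.base x₁ ∈ closure (Set.range fun g : G => (ρX g).hom.base x)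
    · exact huniq x₁ hx₁ x₁' hx₁' hZ heq
    · have hZ' : π.base x₁' ∉ closure (Set.range fun g : G => (ρX g).hom.base x) := heq ▸ hZ
      exact injOn_of_isBlowup_vanishingIdeal isClosed_closure hπ hZ hZ' heq
  · -- `n` is preserved off the orbit
    have hZ : π.base x₁ ∉ closure (Set.range fun g : G => (ρX g).hom.base x) := fun hZ =>
      hO (hnew x₁ hx₁ hZ).1
    haveI := hiso hZ
    exact Scheme.Hom.nodeThickness_comp_eq_of_isIso_stalkMap π f x₁

end Summit.ResolutionOfSingularities.ResolutionOfSingularities.Theorems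

end
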